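import Literature.NumberTheory.DiophantineGeometry.GenEllMechanismAssembly
import Literature.NumberTheory.DiophantineGeometry.GenEllConfigurationProtectionJunction
import Literature.NumberTheory.DiophantineGeometry.GenEllDePersistentValues
import Literature.NumberTheory.DiophantineGeometry.GenEllDeCriticalLocusFamily
import Literature.NumberTheory.DiophantineGeometry.NoncriticalBelyiIntegral
import Literature.NumberTheory.DiophantineGeometry.LogDiffSimpleRootExtension
import Mathlib.FieldTheory.IsAlgClosed.AlgebraicClosure
import Mathlib.RingTheory.DedekindDomain.IntegralClosure
import HarnessLib

/-!
# [GenEll] Thm 2.1 for `ℙ¹` (W9 assembly, piece 3): the mechanism of a configuration —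
# `MechanismFor d ε Pers` modulo the W5 conductor bound

S. Mochizuki, *Arithmetic elliptic curves in general position*, Math. J. Okayama Univ. **52** (2010),
Thm. 2.1 (ii) ⇒ (i), proof pp. 12–13 [cite: MochizukiGenEll2010, Thm 2.1 p.12]; package map
`GENELLTWO-P1ROUTE.md` v3 (abc-iut-S6) §4 «per-configuration protection»; owner's closer skeleton
(STATUS 2026-08-26T02:53:53Z) consumes `MechanismFor d ε Pers := ∀ q ≠ 0, IsCoprime q Pers → ∃ g,
IsCoprime g q ∧ ∀ r > 0, VojtaIneq {P | conjugates r-far from the roots of g at ∞ and at 2} d ε`.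
This file produces that body (`mechanismFor_of_kappa`) from statement (ii) at `Σ = {2}`, `k ≥ 3` with
`(2k+1)/(2k−2) < 1+ε`, `c = 2^j`, a persistent polynomial `Pers` of `c` (d065), and ONE generic
hypothesis `hKappa` — the W5 conductor bound of `GenEllMechanismKappa` (w5-d045), field by field.
Steps (inputs BY NAME): the pole polynomial `c_T` of the configuration (p415691) misses the critical
values of `t_c` (`aeval_polePoly_ne_zero_of_mem_critSetC`: `polePoly_root_not_mem`, d065
`mem_persistentSet_of_tval_eq`, transport `ℚ̄ → ℂ` through d059's `critSetC`); S7's noncritical Belyi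
map protecting its roots (`exists_p1FiniteMap_noncritical_protect`) gives `IsCoprime (f g (f−g)) c_T`
(p416896) and `IsCoprime g_bad q` (p416423 ∘ d015 p416107); `ε'` from `exists_eps_of_margin`; the
integral primitive polynomial `μ` of the field of `B ∪ crit` (`exists_monic_int_splits`) with base
field `K = ℚ[X]/(μ)`; w5-d036's J-A `exists_logDiff_adjoin_root_le`; piece 2
`vojtaIneq_mechanism_of_condBound`.  Theorems only; classical; nothing here bears on [IUTchIII].
-/

noncomputable section

open Polynomial NumberField

namespace Literature.NumberTheory.DiophantineGeometry.GenEll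

/-! ## An integral primitive polynomial whose root fields split a given polynomial -/

/-- **Splitting through an INTEGRAL primitive element.** For `m₀ ∈ ℚ[X]` there is a monic
`μ ∈ ℤ[X]`, irreducible over `ℚ`, such that `m₀` splits over every `ℚ`-algebra field containing a root
of `μ` (the minimal polynomial of an integral primitive element of the splitting field of `m₀`).
[cite: MochizukiGenEll2010, Thm 2.1 proof p.12] -/
theorem exists_monic_int_splits (m₀ : ℚ[X]) :
    ∃ μ : ℤ[X], μ.Monic ∧ Irreducible (μ.map (Int.castRingHom ℚ)) ∧
      ∀ (L : Type) [Field L] [Algebra ℚ L] (θ : L), aeval θ (μ.map (Int.castRingHom ℚ)) = 0 →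
        (m₀.map (algebraMap ℚ L)).Splits := by
  let M := m₀.SplittingField
  obtain ⟨θ₁, hθ₁⟩ := Field.exists_primitive_element ℚ M
  -- an integral multiple `θ = N·θ₁` is still primitive
  obtain ⟨N, hN0, hintall⟩ := exists_integral_multiples ℤ ℚ ({θ₁} : Finset M)
  have hint : IsIntegral ℤ (N • θ₁) := hintall θ₁ (Finset.mem_singleton_self θ₁)
  set θ : M := N • θ₁ with hθdef
  have hθtop : IntermediateField.adjoin ℚ ({θ} : Set M) = ⊤ := by
    refine top_le_iff.mp (hθ₁ ▸ IntermediateField.adjoin_simple_le_iff.mpr ?_)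
    have hmem : θ ∈ IntermediateField.adjoin ℚ ({θ} : Set M) :=
      IntermediateField.mem_adjoin_simple_self ℚ θ
    have hNQ : (N : ℚ) ≠ 0 := by exact_mod_cast hN0
    have hθ₁eq : ((N : ℚ)⁻¹ : ℚ) • θ = θ₁ := by
      rw [hθdef, ← Int.cast_smul_eq_zsmul ℚ N θ₁, smul_smul, inv_mul_cancel₀ hNQ, one_smul]
    rw [← hθ₁eq]
    exact IntermediateField.smul_mem _ hmem
  have hintQ : IsIntegral ℚ θ := Algebra.IsIntegral.isIntegral θ
  have hmap : (minpoly ℤ θ).map (Int.castRingHom ℚ) = minpoly ℚ θ := by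
    rw [← algebraMap_int_eq, ← minpoly.isIntegrallyClosed_eq_field_fractions' ℚ hint]
  refine ⟨minpoly ℤ θ, minpoly.monic hint, ?_, fun L _ _ θ' hθ' => ?_⟩
  · rw [hmap]
    exact minpoly.irreducible hintQ
  · rw [hmap] at hθ'
    -- the embedding `M = ℚ(θ) ≅ ℚ[X]/(μ) → L`
    have hev : (minpoly ℚ θ).eval₂ (Algebra.ofId ℚ L).toRingHom θ' = 0 := by
      rw [aeval_def] at hθ'
      exact hθ'
    let φ₁ : AdjoinRoot (minpoly ℚ θ) →ₐ[ℚ] L :=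
      AdjoinRoot.liftAlgHom (minpoly ℚ θ) (Algebra.ofId ℚ L) θ' hev
    let φ₂ : M ≃ₐ[ℚ] AdjoinRoot (minpoly ℚ θ) :=
      (IntermediateField.topEquiv.symm.trans (IntermediateField.equivOfEq hθtop.symm)).trans
        (IntermediateField.adjoinRootEquivAdjoin ℚ hintQ).symm
    exact (SplittingField.splits m₀).of_algHom (φ₁.comp φ₂.toAlgHom)

/-! ## The pole polynomial misses the complex critical values -/

/-- **No complex critical value of `t_c` is a root of the pole polynomial.** Let `c ∈ ℚ^×`, let
`Pers ∈ ℚ[X]` vanish on the persistent set of `c` over every field of characteristic `0` (d065's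
`persPoly`), let `q` be coprime to `Pers`, and let `c_T ∈ ℚ[X]` have all its `ℚ̄`-roots among the
`t_c`-values at the non-polar `ℚ̄`-points of `D_e` over the roots of `q` (property (b) of
`exists_polePoly`).  Then `c_T(a) ≠ 0` for every `a` of the complex critical set `DeCrit.critSetC k c`:
a complex root `θ` of `R_c` comes from a `ℚ̄`-root `θ₀` (`R_c` splits in `ℚ̄`), the critical point
`Q_{θ₀} ∈ D_e(ℚ̄)` has `t_c(Q_{θ₀}) ↦ a`, and a root of `c_T` colliding with a critical point would
put an entry of the configuration in the persistent set. [cite: MochizukiGenEll2010, Thm 2.1 proof p.12] -/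
theorem aeval_polePoly_ne_zero_of_mem_critSetC {Qb : Type*} [Field Qb] [CharZero Qb] [Algebra ℚ Qb]
    [IsAlgClosure ℚ Qb] {k : ℕ} {c : ℚ} (hc : c ≠ 0) {q Pers cT : ℚ[X]}
    (hcop : IsCoprime q Pers)
    (hroots : ∀ a ∈ DeFamily.persistentSet k (c : Qb), aeval a Pers = 0)
    (hT : ∀ τ : Qb, aeval τ cT = 0 →
      ∃ z : Qb × Qb, z.2 ^ (2 * k + 1) = z.1 * (1 - z.1) ∧
        z.2 ≠ 0 ∧ 1 - 2 * z.1 ≠ 0 ∧ aeval z.1 q = 0 ∧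
          ((1 - 2 * z.1) + algebraMap ℚ Qb c * z.2 ^ (k + 2)) /
            (z.2 * (1 - 2 * z.1)) = τ) :
    ∀ a ∈ DeCrit.critSetC k c, aeval a cT ≠ 0 := by
  have hcQ : (c : Qb) ≠ 0 := by exact_mod_cast hc
  have halgc : algebraMap ℚ Qb c = (c : Qb) := eq_ratCast _ _
  -- the critical values in `ℚ̄`
  let CV : Set Qb := {τ | ∃ w : Qb × Qb, w.2 ^ (2 * k + 1) = w.1 * (1 - w.1) ∧
    DeFamily.N k (c : Qb) w = 0 ∧
      ((1 - 2 * w.1) + (c : Qb) * w.2 ^ (k + 2)) / (w.2 * (1 - 2 * w.1)) = τ}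
  have hCV : ∀ z : Qb × Qb, z.2 ^ (2 * k + 1) = z.1 * (1 - z.1) → z.2 ≠ 0 → 1 - 2 * z.1 ≠ 0 →
      ((1 - 2 * z.1) + algebraMap ℚ Qb c * z.2 ^ (k + 2)) / (z.2 * (1 - 2 * z.1)) ∈ CV →
        aeval z.1 Pers = 0 := by
    intro z hz hr hs hmem
    obtain ⟨w, hw, hN, hτ⟩ := hmem
    rw [halgc] at hτ
    exact hroots z.1 (DeFamily.mem_persistentSet_of_tval_eq hcQ hz ⟨hr, hs⟩ hw hN hτ.symm)
  have hnot := ConfigurationProtection.polePoly_root_not_mem (L := Qb) k c hcop CV hCV hT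
  -- transport a complex critical value to `ℚ̄`
  intro a ha hcTa
  obtain ⟨θ, hθR, hθa⟩ := DeCrit.mem_critSetC_iff.mp ha
  haveI : IsAlgClosed Qb := IsAlgClosure.isAlgClosed ℚ
  haveI : Algebra.IsAlgebraic ℚ Qb := IsAlgClosure.isAlgebraic
  let ι : Qb →ₐ[ℚ] ℂ := IsAlgClosed.lift
  have hιc : (ι : Qb →+* ℂ) (c : Qb) = (c : ℂ) := by simp
  -- `θ = ι θ₀` for a `ℚ̄`-root `θ₀` of `R_c`
  have hsplit : (DeCrit.RpolyC k (c : Qb)).Splits := IsAlgClosed.splits _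
  have hmapR : (DeCrit.RpolyC k (c : Qb)).map (ι : Qb →+* ℂ) = DeCrit.RpolyC k (c : ℂ) := by
    rw [DeCrit.map_RpolyC, hιc]
  have hR0 : DeCrit.RpolyC k (c : ℂ) ≠ 0 := DeCrit.RpolyC_ne_zero k _
  have hθroot : θ ∈ (DeCrit.RpolyC k (c : ℂ)).roots := (mem_roots hR0).mpr hθR
  rw [← hmapR, hsplit.roots_map, Multiset.mem_map] at hθroot
  obtain ⟨θ₀, hθ₀, rfl⟩ := hθroot
  have hθ₀R : (DeCrit.RpolyC k (c : Qb)).eval θ₀ = 0 :=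
    (mem_roots (DeCrit.RpolyC_ne_zero k _)).mp hθ₀
  -- the critical point `Q_{θ₀}` over `ℚ̄`
  have h2 : (2 : Qb) ≠ 0 := two_ne_zero
  have he : ((2 * k + 1 : ℕ) : Qb) ≠ 0 := DeArch.cast_two_mul_add_one_ne_zero k
  have hcurve := DeCrit.critPointC_mem k h2 he hcQ hθ₀R
  have hN := DeCrit.NvalC_critPointC k h2 he hcQ hθ₀R
  have htc : DeCrit.tC k (c : Qb) (DeCrit.critXC k (c : Qb) θ₀) θ₀ = DeCrit.tCritC k (c : Qb) θ₀ :=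
    DeCrit.tC_critPointC h2 _ _
  have hmemCV : DeCrit.tCritC k (c : Qb) θ₀ ∈ CV := by
    refine ⟨DeCrit.critPointC k (c : Qb) θ₀, hcurve, ?_, ?_⟩
    · exact hN
    · rw [← htc]; rfl
  -- `c_T(t_c(Q_{θ₀})) = 0` by transport along `ι`
  have hτa : (ι : Qb →+* ℂ) (DeCrit.tCritC k (c : Qb) θ₀) = a := by
    rw [DeCrit.map_tCritC, hιc, hθa]
  have hroot₀ : aeval (DeCrit.tCritC k (c : Qb) θ₀) cT = 0 := by
    have h := hcTa
    rw [← hτa] at h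
    have : aeval ((ι : Qb →+* ℂ) (DeCrit.tCritC k (c : Qb) θ₀)) cT =
        ι (aeval (DeCrit.tCritC k (c : Qb) θ₀) cT) := by
      rw [show ((ι : Qb →+* ℂ) (DeCrit.tCritC k (c : Qb) θ₀)) = ι (DeCrit.tCritC k (c : Qb) θ₀)
        from rfl, aeval_algHom_apply]
    rw [this] at h
    exact (ι : Qb →+* ℂ).injective (h.trans (map_zero _).symm)
  exact hnot _ hroot₀ hmemCV

/-- Vanishing of `aeval` does not depend on the (unique) `ℚ`-algebra structure of a division ring
(bookkeeping across the two `ℚ`-algebra instances of `AdjoinRoot`/tower fields). [folklore] -/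
private theorem aeval_eq_zero_of_subsingleton {A : Type*} [DivisionRing A] (inst₁ inst₂ : Algebra ℚ A)
    {x : A} {p : ℚ[X]} (h : @aeval ℚ A _ _ inst₁ x p = 0) : @aeval ℚ A _ _ inst₂ x p = 0 := by
  rw [Subsingleton.elim inst₂ inst₁]
  exact h

/-! ## `MechanismFor d ε Pers`, modulo the W5 conductor bound -/

/-- **The mechanism of a configuration** (S6's `MechanismFor d ε Pers`, body unfolded), **modulo the
W5 conductor bound `hKappa`** (stated field by field: for every Belyi datum `φ = (f : g)` of S7's shape
sending the complex critical values of `t_c` to cusps, every number field `K` splitting `R_c` and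
`f g (f−g)`, every degree bound `Nd` and margin `ρ > 0`, a constant `C₂` with
`log-cond_{φ^*C}(t_c(x,r)) ≤ B_c·ht(x) + C₂` over every number field `L ⊇ K` of degree `≤ Nd` splitting
`f g (f−g)`, at every non-polar `(x, r) ∈ D_e(L)` off the cusp fibre with conjugates `ρ`-far from the
bad roots at `∞` and at `2`).  Conclusion: for every configuration polynomial `q ≠ 0` coprime to
`Pers` there is `g` coprime to `q` with Vojta in degree `≤ d` on the `r`-far sets, all `r > 0` — the
hypothesis `hmech` of `vojtaIneq_univ_of_persistent` (p414390) at `p = 2`.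
[cite: MochizukiGenEll2010, Thm 2.1 proof pp.12–13] -/
theorem mechanismFor_of_kappa (h2 : ABCCompactlyBounded ({2} : Finset ℕ)) {d : ℕ} (hd : 0 < d)
    {ε : ℝ} (hε : 0 < ε) {k : ℕ} (hk : 3 ≤ k)
    (hke : ((2 * k + 1 : ℕ) : ℝ) / (((2 * k + 1 : ℕ) : ℝ) - 3) < 1 + ε)
    {c : ℚ} (hc : c ∈ Set.range (fun j : ℕ => (2 : ℚ) ^ j)) {Pers : ℚ[X]}
    (hroots : ∀ a ∈ DeFamily.persistentSet k (c : ℂ), aeval a Pers = 0)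
    (hKappa : ∀ φ : P1FiniteMap, 0 < φ.deg → φ.num.natDegree = φ.deg → φ.den.natDegree = φ.deg →
      (φ.num - φ.den).natDegree = φ.deg →
      (∀ a ∈ DeCrit.critSetC k c, aeval a (φ.num * φ.den * (φ.num - φ.den)) = 0) →
      ((φ.num * φ.den * (φ.num - φ.den)).map (Int.castRingHom ℂ)).roots.toFinset.card
        ≤ φ.deg + 2 →
      ∀ (K : Type) [Field K] [NumberField K], (DeCrit.RpolyC k (c : K)).Splits →
      ((φ.num * φ.den * (φ.num - φ.den)).map (Int.castRingHom K)).Splits →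
      ∀ (Nd : ℕ) (ρ : ℝ), 0 < ρ → ∃ C₂ : ℝ, ∀ (L : Type) [Field L] [NumberField L] [Algebra K L],
        Module.finrank ℚ L ≤ Nd → ∀ (x r : L),
        r ^ (2 * k + 1) = x * (1 - x) → x ≠ 0 → x ≠ 1 → r ≠ 0 → 1 - 2 * x ≠ 0 →
        ((φ.num * φ.den * (φ.num - φ.den)).map (Int.castRingHom L)).Splits →
        aeval (DeCrit.tC k (algebraMap ℚ L c) x r) (φ.num * φ.den * (φ.num - φ.den)) ≠ 0 →
        (∀ σ : L →+* ℂ, ∀ a ∈ (resultant (De.curvePoly k) (De.homFibrePolyC k c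
          (φ.num.map (Int.castRingHom ℚ) * φ.den.map (Int.castRingHom ℚ) *
            (φ.num.map (Int.castRingHom ℚ) - φ.den.map (Int.castRingHom ℚ))))).aroots ℂ,
          ρ < ‖σ x - a‖) →
        (∀ σ : L →+* PadicAlgCl 2, ∀ a ∈ (resultant (De.curvePoly k) (De.homFibrePolyC k c
          (φ.num.map (Int.castRingHom ℚ) * φ.den.map (Int.castRingHom ℚ) *
            (φ.num.map (Int.castRingHom ℚ) - φ.den.map (Int.castRingHom ℚ))))).aroots
            (PadicAlgCl 2), ρ < ‖σ x - a‖) →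
        (⟨L, DeCrit.tC k (algebraMap ℚ L c) x r⟩ : NFPoint).logCondDiv φ.pullbackCusps ≤
          ((φ.deg + 2 : ℝ) * (2 * k + 4) - (6 * k + 6)) / (2 * k + 1) * (⟨L, x⟩ : NFPoint).ht
            + C₂) :
    ∀ q : ℚ[X], q ≠ 0 → IsCoprime q Pers → ∃ g : ℚ[X], IsCoprime g q ∧ ∀ r : ℝ, 0 < r →
      VojtaIneq {P : NFPoint | (∀ σ : P.F →+* ℂ, ∀ a ∈ g.aroots ℂ, r < ‖σ P.x - a‖) ∧
        (∀ σ : P.F →+* PadicAlgCl 2, ∀ a ∈ g.aroots (PadicAlgCl 2), r < ‖σ P.x - a‖)} d ε := by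
  classical
  intro q hq0 hqP
  have hc0 : c ≠ 0 := by
    obtain ⟨j, hj⟩ := hc
    rw [← hj]
    exact pow_ne_zero _ two_ne_zero
  have hk1 : 1 ≤ k := by omega
  have he : 0 < 2 * k + 1 := by omega
  -- `ℚ̄` with the algebra structure of its construction (for the `IsAlgClosure` instance)
  letI instA : Algebra ℚ (AlgebraicClosure ℚ) := AlgebraicClosure.instAlgebra ℚ
  -- the persistent-root clause over `ℚ̄`, transported from `ℂ`
  have hrootsQ : ∀ a ∈ DeFamily.persistentSet k (c : AlgebraicClosure ℚ), aeval a Pers = 0 := by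
    intro a ha
    haveI : Algebra.IsAlgebraic ℚ (AlgebraicClosure ℚ) := IsAlgClosure.isAlgebraic
    let ι : AlgebraicClosure ℚ →ₐ[ℚ] ℂ := IsAlgClosed.lift
    have h := hroots _ (DeFamily.mem_persistentSet_map (ι : AlgebraicClosure ℚ →+* ℂ) ha)
    rw [show ((ι : AlgebraicClosure ℚ →+* ℂ) a) = ι a from rfl, aeval_algHom_apply] at h
    exact (ι : AlgebraicClosure ℚ →+* ℂ).injective (h.trans (map_zero _).symm)
  -- the pole polynomial of the configuration and its avoidance of the critical values
  obtain ⟨cT, hcT0, hTa, hTb⟩ :=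
    ConfigurationProtection.exists_polePoly (L := AlgebraicClosure ℚ) k c hq0
  have hGA : ∀ a ∈ DeCrit.critSetC k c, aeval a cT ≠ 0 :=
    aeval_polePoly_ne_zero_of_mem_critSetC (Qb := AlgebraicClosure ℚ) hc0 hqP hrootsQ hTb
  -- S7: the noncritical Belyi map protecting the roots of `c_T`
  obtain ⟨φ, hdeg, hnum, hden, hsub, -, hcop, -, hAcusps, hprot, -, hcount⟩ :=
    NoncriticalBelyi.exists_p1FiniteMap_noncritical_protect (DeCrit.critSetC k c)
      (fun a ha => DeCrit.isAlgebraic_of_mem_critSetC ha) cT hcT0 hGA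
  -- rational forms
  have hinj : Function.Injective (Int.castRingHom ℚ) := (Int.castRingHom ℚ).injective_int
  have hpn : (φ.num.map (Int.castRingHom ℚ)).natDegree = φ.deg := by
    rw [natDegree_map_eq_of_injective hinj, hnum]
  have hqn : (φ.den.map (Int.castRingHom ℚ)).natDegree = φ.deg := by
    rw [natDegree_map_eq_of_injective hinj, hden]
  have hpqn : (φ.num.map (Int.castRingHom ℚ) - φ.den.map (Int.castRingHom ℚ)).natDegree
      = φ.deg := by
    rw [← Polynomial.map_sub, natDegree_map_eq_of_injective hinj, hsub]
  have hp0 : φ.num.map (Int.castRingHom ℚ) ≠ 0 := fun h => by rw [h, natDegree_zero] at hpn; omega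
  have hq0' : φ.den.map (Int.castRingHom ℚ) ≠ 0 := fun h => by rw [h, natDegree_zero] at hqn; omega
  have hne : φ.num.map (Int.castRingHom ℚ) ≠ φ.den.map (Int.castRingHom ℚ) := fun h => by
    rw [h, sub_self, natDegree_zero] at hpqn; omega
  have hmZ : φ.num.map (Int.castRingHom ℚ) * φ.den.map (Int.castRingHom ℚ) *
      (φ.num.map (Int.castRingHom ℚ) - φ.den.map (Int.castRingHom ℚ)) =
      (φ.num * φ.den * (φ.num - φ.den)).map (Int.castRingHom ℚ) := by
    rw [Polynomial.map_mul, Polynomial.map_mul, Polynomial.map_sub]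
  have hm0 : φ.num.map (Int.castRingHom ℚ) * φ.den.map (Int.castRingHom ℚ) *
      (φ.num.map (Int.castRingHom ℚ) - φ.den.map (Int.castRingHom ℚ)) ≠ 0 :=
    mul_ne_zero (mul_ne_zero hp0 hq0') (sub_ne_zero.mpr hne)
  have haeZ : ∀ {S : Type} [Field S] [Algebra ℚ S] (F : ℤ[X]) (y : S),
      aeval y (F.map (Int.castRingHom ℚ)) = aeval y F := fun F y => by
    rw [← algebraMap_int_eq, aeval_map_algebraMap]
  -- the integer form mapped to any `ℚ`-algebra is the rational form mapped
  have hmapZ : ∀ {S : Type} [Field S] [Algebra ℚ S],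
      (φ.num * φ.den * (φ.num - φ.den)).map (Int.castRingHom S) =
        (φ.num.map (Int.castRingHom ℚ) * φ.den.map (Int.castRingHom ℚ) *
          (φ.num.map (Int.castRingHom ℚ) - φ.den.map (Int.castRingHom ℚ))).map
          (algebraMap ℚ S) := fun {S} _ _ => by
    rw [hmZ, Polynomial.map_map]
    congr 1
    exact RingHom.ext_int _ _
  -- `f g (f − g)` is coprime to `c_T` (protection), hence the bad polynomial is coprime to `q`
  have hmT : IsCoprime (φ.num.map (Int.castRingHom ℚ) * φ.den.map (Int.castRingHom ℚ) *
      (φ.num.map (Int.castRingHom ℚ) - φ.den.map (Int.castRingHom ℚ))) cT :=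
    ConfigurationProtection.isCoprime_mul_mul_sub_of_forall_root (Ω := ℂ) fun γ hγ => by
      obtain ⟨h1, h2', h3⟩ := hprot γ hγ
      rw [haeZ, haeZ]
      exact ⟨h1, h2', h3⟩
  have hgq : IsCoprime (resultant (De.curvePoly k) (De.homFibrePolyC k c
      (φ.num.map (Int.castRingHom ℚ) * φ.den.map (Int.castRingHom ℚ) *
        (φ.num.map (Int.castRingHom ℚ) - φ.den.map (Int.castRingHom ℚ))))) q :=
    ConfigurationProtection.isCoprime_of_rootSet_eq (L := AlgebraicClosure ℚ) k c
      (De.rootSet_resultant_homFibrePolyC (Ω := AlgebraicClosure ℚ) k hc0 hm0)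
      (De.resultant_homFibrePolyC_ne_zero k c hm0) hTa hmT
  refine ⟨_, hgq, fun ρ hρ => ?_⟩
  -- the primitive integral polynomial `μ` of the field of `B ∪ crit`, and the base field `K = ℚ(θ)`
  obtain ⟨μ, hμmonic, hμirr, hμsplits⟩ := exists_monic_int_splits
    (DeCrit.RpolyC k c * (φ.num.map (Int.castRingHom ℚ) * φ.den.map (Int.castRingHom ℚ) *
      (φ.num.map (Int.castRingHom ℚ) - φ.den.map (Int.castRingHom ℚ))))
  have hμdeg : (μ.map (Int.castRingHom ℚ)).natDegree ≠ 0 := hμirr.natDegree_pos.ne'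
  have hμsep : (μ.map (Int.castRingHom ℚ)).Separable := hμirr.separable
  have hprod0 : DeCrit.RpolyC k c * (φ.num.map (Int.castRingHom ℚ) *
      φ.den.map (Int.castRingHom ℚ) *
        (φ.num.map (Int.castRingHom ℚ) - φ.den.map (Int.castRingHom ℚ))) ≠ 0 :=
    mul_ne_zero (DeCrit.RpolyC_ne_zero k c) hm0
  -- the splitting of both factors in any field containing a root of `μ`
  have hsplitR : ∀ (S : Type) [Field S] [Algebra ℚ S] (θ : S),
      aeval θ (μ.map (Int.castRingHom ℚ)) = 0 → (DeCrit.RpolyC k (algebraMap ℚ S c)).Splits := by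
    intro S _ _ θ hθ
    have h := (hμsplits S θ hθ).of_dvd
      ((Polynomial.map_ne_zero_iff (algebraMap ℚ S).injective).mpr hprod0)
      (Polynomial.map_dvd _ (dvd_mul_right _ _))
    rwa [DeCrit.map_RpolyC] at h
  have hsplitB : ∀ (S : Type) [Field S] [Algebra ℚ S] (θ : S),
      aeval θ (μ.map (Int.castRingHom ℚ)) = 0 →
        ((φ.num * φ.den * (φ.num - φ.den)).map (Int.castRingHom S)).Splits := by
    intro S _ _ θ hθ
    have h := (hμsplits S θ hθ).of_dvd
      ((Polynomial.map_ne_zero_iff (algebraMap ℚ S).injective).mpr hprod0)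
      (Polynomial.map_dvd _ (dvd_mul_left _ _))
    rwa [← hmapZ] at h
  haveI hfact : Fact (Irreducible (μ.map (Int.castRingHom ℚ))) := ⟨hμirr⟩
  haveI : Module.Finite ℚ (AdjoinRoot (μ.map (Int.castRingHom ℚ))) :=
    (AdjoinRoot.powerBasis hμirr.ne_zero).finite
  haveI : NumberField (AdjoinRoot (μ.map (Int.castRingHom ℚ))) := NumberField.of_module_finite ℚ _
  have hrootK : ∀ (inst : Algebra ℚ (AdjoinRoot (μ.map (Int.castRingHom ℚ)))),
      @aeval ℚ (AdjoinRoot (μ.map (Int.castRingHom ℚ))) _ _ inst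
        (AdjoinRoot.root (μ.map (Int.castRingHom ℚ))) (μ.map (Int.castRingHom ℚ)) = 0 := by
    intro inst
    have h0 := AdjoinRoot.aeval_eq (f := μ.map (Int.castRingHom ℚ)) (μ.map (Int.castRingHom ℚ))
    rw [AdjoinRoot.mk_self] at h0
    exact aeval_eq_zero_of_subsingleton _ inst h0
  have hKR : (DeCrit.RpolyC k (c : AdjoinRoot (μ.map (Int.castRingHom ℚ)))).Splits := by
    have h := hsplitR (AdjoinRoot (μ.map (Int.castRingHom ℚ)))
      (AdjoinRoot.root (μ.map (Int.castRingHom ℚ))) (hrootK _)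
    rwa [eq_ratCast] at h
  have hKB := hsplitB (AdjoinRoot (μ.map (Int.castRingHom ℚ)))
    (AdjoinRoot.root (μ.map (Int.castRingHom ℚ))) (hrootK _)
  -- the conductor-bound constant of the W5 capstone
  obtain ⟨C₂, hC₂⟩ := hKappa φ hdeg hnum hden hsub hAcusps hcount.le
    (AdjoinRoot (μ.map (Int.castRingHom ℚ))) hKR hKB
    ((μ.map (Int.castRingHom ℚ)).natDegree * ((2 * k + 1) * d)) ρ hρ
  -- the log-different of the fixed layer (w5-d036, J-A)
  obtain ⟨D, -, hD⟩ := exists_logDiff_adjoin_root_le μ hμmonic hμsep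
  -- the slope: `ε'` from the Riemann–Hurwitz margin `(2k−2)/(2k+1)`
  have hk0 : (0 : ℝ) < 2 * k + 1 := by positivity
  have hk3 : (3 : ℝ) ≤ k := by exact_mod_cast hk
  have hmpos : (0 : ℝ) < ((2 * k + 1 : ℝ) - 3) / (2 * k + 1) := by
    apply div_pos <;> linarith
  have hmε : 1 / (((2 * k + 1 : ℝ) - 3) / (2 * k + 1)) < 1 + ε := by
    rw [one_div, inv_div]
    have : ((2 * k + 1 : ℕ) : ℝ) = 2 * k + 1 := by push_cast; ring
    rwa [this] at hke
  have hBc : (0 : ℝ) ≤ ((φ.deg + 2 : ℝ) * (2 * k + 4) - (6 * k + 6)) / (2 * k + 1) := by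
    apply div_nonneg _ hk0.le
    have : (1 : ℝ) ≤ φ.deg := by exact_mod_cast hdeg
    nlinarith
  obtain ⟨ε', hε'0, hslope', hε'⟩ := exists_eps_of_margin hε hmpos hmε hBc
  have hAB : (φ.deg : ℝ) * (2 * k + 4) / (2 * k + 1) -
      (1 + ε') * (((φ.deg + 2 : ℝ) * (2 * k + 4) - (6 * k + 6)) / (2 * k + 1)) =
      ((2 * k + 1 : ℝ) - 3) / (2 * k + 1) -
        ε' * (((φ.deg + 2 : ℝ) * (2 * k + 4) - (6 * k + 6)) / (2 * k + 1)) := by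
    field_simp
    ring
  -- piece 2
  refine vojtaIneq_mechanism_of_condBound k c φ (μ.map (Int.castRingHom ℚ)) h2 hk1 hc0 hdeg hnum
    hden hsub hcop hμdeg hd hε'0 hρ _ (fun P hP => hP.1) (fun P hP => hP.2) (C₂ := C₂) (D := D)
    ?_ ?_ (by rw [hAB]; exact hslope') (by rw [hAB]; exact hε')
  · -- hκ from the W5 capstone over `L_P = F(r)(θ) ⊇ K = ℚ(θ)`
    intro P hP hhalf haev
    have hθ := P.aeval_mechTheta (2 * k + 1) (μ.map (Int.castRingHom ℚ)) hμdeg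
    have hθ' : (μ.map (Int.castRingHom ℚ)).eval₂
        (algebraMap ℚ (P.mechField (2 * k + 1) (μ.map (Int.castRingHom ℚ))))
        (P.mechTheta (2 * k + 1) (μ.map (Int.castRingHom ℚ))) = 0 := by
      rw [← aeval_def]
      exact aeval_eq_zero_of_subsingleton _ _ hθ
    let ιK : AdjoinRoot (μ.map (Int.castRingHom ℚ)) →+*
        P.mechField (2 * k + 1) (μ.map (Int.castRingHom ℚ)) :=
      AdjoinRoot.lift (algebraMap ℚ _) (P.mechTheta (2 * k + 1) (μ.map (Int.castRingHom ℚ))) hθ'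
    letI : Algebra (AdjoinRoot (μ.map (Int.castRingHom ℚ)))
        (P.mechField (2 * k + 1) (μ.map (Int.castRingHom ℚ))) := ιK.toAlgebra
    have hPU : P.InU := hP.2.1.1
    have hxU := (P.inU_mechPoint_iff (2 * k + 1) (μ.map (Int.castRingHom ℚ))).mpr hPU
    have hr := P.mechRoot_ne_zero (2 * k + 1) (μ.map (Int.castRingHom ℚ)) hPU he
    have hs := (P.one_sub_two_mul_mechPoint_x_ne_zero_iff (2 * k + 1)
      (μ.map (Int.castRingHom ℚ))).mpr hhalf
    have hcurve := P.mechRoot_pow (2 * k + 1) (μ.map (Int.castRingHom ℚ)) he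
    have hsplitZ := hsplitB (P.mechField (2 * k + 1) (μ.map (Int.castRingHom ℚ)))
      (P.mechTheta (2 * k + 1) (μ.map (Int.castRingHom ℚ))) hθ
    have hNd : Module.finrank ℚ (P.mechField (2 * k + 1) (μ.map (Int.castRingHom ℚ))) ≤
        (μ.map (Int.castRingHom ℚ)).natDegree * ((2 * k + 1) * d) :=
      P.degree_mechPoint_le_of_le (2 * k + 1) (μ.map (Int.castRingHom ℚ)) he hμdeg hP.2.2 le_rfl
    have key := hC₂ (P.mechField (2 * k + 1) (μ.map (Int.castRingHom ℚ))) hNd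
      (P.mechPoint (2 * k + 1) (μ.map (Int.castRingHom ℚ))).x
      (P.mechRoot (2 * k + 1) (μ.map (Int.castRingHom ℚ))) hcurve hxU.1 hxU.2 hr hs hsplitZ haev
      (fun σ a ha => hP.1.1
        (σ.comp (algebraMap P.F (P.mechField (2 * k + 1) (μ.map (Int.castRingHom ℚ))))) a ha)
      (fun σ a ha => hP.1.2
        (σ.comp (algebraMap P.F (P.mechField (2 * k + 1) (μ.map (Int.castRingHom ℚ))))) a ha)
    have hht : (⟨P.mechField (2 * k + 1) (μ.map (Int.castRingHom ℚ)),
        (P.mechPoint (2 * k + 1) (μ.map (Int.castRingHom ℚ))).x⟩ : NFPoint).ht = P.ht :=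
      P.ht_mechPoint (2 * k + 1) (μ.map (Int.castRingHom ℚ))
    rw [hht] at key
    exact key
  · -- hD from J-A at `θ := P.mechTheta`
    intro P hP _
    refine hD (P.dePoint (2 * k + 1)) (P.mechPoint (2 * k + 1) (μ.map (Int.castRingHom ℚ)))
      (P.mechTheta (2 * k + 1) (μ.map (Int.castRingHom ℚ))) ?_
      (P.adjoin_mechTheta (2 * k + 1) (μ.map (Int.castRingHom ℚ)))
    rw [← haeZ]
    exact P.aeval_mechTheta (2 * k + 1) (μ.map (Int.castRingHom ℚ)) hμdeg

end Literature.NumberTheory.DiophantineGeometry.GenEll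

end
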